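import Literature.NumberTheory.GaloisRepresentations.FrobeniusDensity
import Literature.NumberTheory.Automorphic.ChebotarevArtinRepHolds
import Literature.NumberTheory.GaloisRepresentations.WeilLAdicCharacterProofs
import Literature.NumberTheory.GaloisRepresentations.HeckeCharacterWeakApproximation
import Literature.NumberTheory.GaloisRepresentations.IntegralGaloisActionProofs
import Literature.FieldTheory.AlgClosed.PadicAlgClEquivComplex
import Literature.RepresentationTheory.Semisimple.FiniteFieldDescentFinTwo
import HarnessLib

/-!
# A character taking, at a Frobenius-dense set of places, one of two prescribed Frobenius values is one
# of the two characters (abelian case of Rajan's refinement of strong multiplicity one, finite/degree-one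
# exceptional sets — no density argument)

Topic `NumberTheory/GaloisRepresentations`; namespace `Literature.NumberTheory.GaloisRepresentations`.
A *proofs* file (theorems only; no definition, no named fact, no instance).

**The lemma.** Let `ψ, μ₁, μ₂` be continuous characters (more generally continuous homomorphisms
`Γ → M` into a Hausdorff topological monoid) of a topological group `Γ`, and suppose `ψ(x) ∈ {μ₁(x), μ₂(x)}`
for every `x` in a DENSE subset `D ⊆ Γ`.  Then `ψ = μ₁` or `ψ = μ₂`.  Proof: the equalisers
`H_i = {ψ = μ_i}` are CLOSED SUBGROUPS with `D ⊆ H₁ ∪ H₂`, hence `Γ = H₁ ∪ H₂`, and no group is the union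
of two proper subgroups (`Literature.RepresentationTheory.Semisimple.subgroup_eq_top_or_eq_top_of_union`).
This is the abelian case of [Rajan 2000, Thm. 1] («if `tr ρ₁(Frob_v) = tr ρ₂(Frob_v)` on a set of places of
positive upper density then `ρ₁ ≅ ρ₂ ⊗ η` with `η` of finite order») in the situation where the agreement
set is Frobenius-DENSE (e.g. all places outside a finite set, or all degree-one places outside a finite
set): there the finite-order character `η` never appears and NO density form of Chebotarev is needed —
only the density of Frobenius elements (`absoluteGaloisGroup.frobenius_dense`, Serre, *Abelian `ℓ`-adic
representations* I-2.2 Cor. 2 (a), from Chebotarev in existence form `Automorphic.chebotarev_artinRep_holds`).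

**Contents.**
* §1 `ContinuousMonoidHom.eq_or_eq_of_dense` — the generic statement.
* §2 `FramedGaloisRep.eq_or_eq_of_frobenius_of_dense` — framed Galois representations `Γ_K →ₜ* GL_n(A)` of a
  number field agreeing, at every arithmetic Frobenius over a place set `P` whose Frobenii are dense, with
  one of two given representations; `FramedGaloisRep.eq_or_eq_of_frobenius` — the case «all places outside a
  finite set `S`» with ZERO hypotheses; rank-one charpoly forms `FramedRep.apply_eq_of_charpoly_eq`,
  `FramedGaloisRep.eq_or_eq_of_hasFrobCharpolyAt` (the shape Weil's theorem
  `HeckeCharacter.IsAlgebraic.exists_lAdic` produces).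
* §3 `HeckeCharacter.IsAlgebraic.eq_or_eq_of_valueAtUniformizer` — the HECKE side: algebraic Hecke characters
  `ψ, μ₁, μ₂` of `K` with `ψ(ϖ_v) ∈ {μ₁(ϖ_v), μ₂(ϖ_v)}` for all `v` outside a finite set satisfy `ψ = μ₁` or
  `ψ = μ₂` (Weil's `ℓ`-adic avatars at `ℓ = 2`, §2, and rigidity
  `HeckeCharacter.ext_of_eventually_valueAtUniformizer_eq`); `…_of_dense` — the same over any place set whose
  Frobenii stay dense after removing finitely many places (degree-one places, split places, …).

Consumer: the «(S-Raj)» step of [Liu2021, Thm. D.6 (1)] (proof §D.4, l. 5625: «by [Raj00, Thm 1] …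
`μ̃ = μ_i η_i` … which is not true») in the cut {(S-D9), (S-D4), (S-Raj), (S-CM)} of the registered residual
`thmD6OneCurveCUF`: with a FINITE (or degree-one) exceptional set the step is this file's theorem, not a fact.

## References
* C. S. Rajan, *Refinement of strong multiplicity one*, Thm. 1. [Rajan2000]
* J.-P. Serre, *Abelian ℓ-adic representations and elliptic curves* (1968), Ch. I §2.2 Cor. 2. [SerreAbelianLadic1968]
* A. Weil, *On a certain type of characters of the idèle-class group of an algebraic number-field* (1956). [Weil1956]
* Y. Liu, *Fourier–Jacobi cycles and arithmetic relative trace formula*, Camb. J. Math. 9 (2021), App. D §D.4. [Liu2021]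
-/

noncomputable section

open scoped NumberField Topology Polynomial
open IsDedekindDomain Field Filter Polynomial

namespace Literature.NumberTheory.GaloisRepresentations

/-! ### §1 The generic statement: continuous homomorphisms into a Hausdorff monoid -/

section Generic

variable {G : Type*} {M : Type*} [Group G] [TopologicalSpace G] [Monoid M] [TopologicalSpace M] [T2Space M]

/-- **A continuous homomorphism that agrees pointwise, on a dense set, with one of two given continuous
homomorphisms is one of them.**  For `f g₁ g₂ : G →ₜ* M` (`G` a topological group, `M` a Hausdorff
topological monoid) and a dense `D ⊆ G` with `f x = g₁ x ∨ f x = g₂ x` for all `x ∈ D`: `f = g₁ ∨ f = g₂`.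
The equalisers `{f = g_i}` (Mathlib `MonoidHom.eqLocus`) are closed subgroups covering `D`, hence `G`, and a
group is not the union of two proper subgroups.  Abelian shadow of [Rajan 2000, Thm. 1].
[cite: Rajan2000, Thm. 1 p. 691 (case m = 1)] [cite: SerreAbelianLadic1968, Ch. I §2.2 Cor. 2 (a) p. I-8] -/
theorem ContinuousMonoidHom.eq_or_eq_of_dense (f g₁ g₂ : G →ₜ* M) {D : Set G} (hD : Dense D)
    (h : ∀ x ∈ D, f x = g₁ x ∨ f x = g₂ x) : f = g₁ ∨ f = g₂ := by
  let H₁ : Subgroup G := MonoidHom.eqLocus f.toMonoidHom g₁.toMonoidHom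
  let H₂ : Subgroup G := MonoidHom.eqLocus f.toMonoidHom g₂.toMonoidHom
  have hm₁ : ∀ x, x ∈ H₁ ↔ f x = g₁ x := fun _ => Iff.rfl
  have hm₂ : ∀ x, x ∈ H₂ ↔ f x = g₂ x := fun _ => Iff.rfl
  have he₁ : (H₁ : Set G) = {x | f x = g₁ x} := Set.ext fun x => hm₁ x
  have he₂ : (H₂ : Set G) = {x | f x = g₂ x} := Set.ext fun x => hm₂ x
  have hc₁ : IsClosed (H₁ : Set G) := by
    rw [he₁]; exact isClosed_eq (map_continuous f) (map_continuous g₁)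
  have hc₂ : IsClosed (H₂ : Set G) := by
    rw [he₂]; exact isClosed_eq (map_continuous f) (map_continuous g₂)
  have hsub : D ⊆ (H₁ : Set G) ∪ (H₂ : Set G) := fun y hy => (h y hy).imp (hm₁ y).2 (hm₂ y).2
  have hall : ∀ x, x ∈ H₁ ∨ x ∈ H₂ := by
    intro x
    have hx : x ∈ closure D := by
      rw [hD.closure_eq]
      exact Set.mem_univ x
    exact (hc₁.union hc₂).closure_subset_iff.2 hsub hx
  rcases Literature.RepresentationTheory.Semisimple.subgroup_eq_top_or_eq_top_of_union H₁ H₂ hall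
    with hH | hH
  · exact Or.inl (ContinuousMonoidHom.ext fun x => (hm₁ x).1 ((Subgroup.eq_top_iff' H₁).1 hH x))
  · exact Or.inr (ContinuousMonoidHom.ext fun x => (hm₂ x).1 ((Subgroup.eq_top_iff' H₂).1 hH x))

end Generic

/-! ### §2 Framed Galois representations and Frobenius elements -/

section Frobenius

variable {K : Type} [Field K] [NumberField K] {A : Type*} [CommRing A] [TopologicalSpace A] {n : ℕ}

omit [NumberField K] in
/-- **Frobenius form over a Frobenius-dense set of places.**  Let `r r₁ r₂ : Γ_K →ₜ* GL_n(A)` be framed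
Galois representations of a number field `K` (`A` any Hausdorff topological ring) and `P` a set of finite
places whose arithmetic Frobenius elements are dense in `Γ_K`.  If at every `v ∈ P`, every prime `𝔓 ∣ v` of
`\bar ℤ_K` and every arithmetic Frobenius `σ` at `𝔓` one has `r σ = r₁ σ` or `r σ = r₂ σ`, then `r = r₁` or
`r = r₂`.  The place set is a PARAMETER: for `P = {v ∉ S}` (`S` finite) the density is
`absoluteGaloisGroup.frobenius_dense` (`eq_or_eq_of_frobenius` below); for degree-one / split place sets it is
the corresponding refinement of Chebotarev, supplied by the caller.
[cite: Rajan2000, Thm. 1 p. 691 (case m = 1)] [cite: SerreAbelianLadic1968, Ch. I §2.2 Cor. 2 (a) p. I-8] -/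
theorem FramedGaloisRep.eq_or_eq_of_frobenius_of_dense [T2Space A] (r r₁ r₂ : FramedGaloisRep K A n)
    (P : Set (HeightOneSpectrum (𝓞 K)))
    (hP : Dense {σ : absoluteGaloisGroup K | ∃ v ∈ P, ∃ 𝔓 ∈ v.primesAbove, IsArithFrobAt (𝓞 K) σ 𝔓})
    (h : ∀ v ∈ P, ∀ 𝔓 ∈ v.primesAbove, ∀ σ : absoluteGaloisGroup K, IsArithFrobAt (𝓞 K) σ 𝔓 →
      r σ = r₁ σ ∨ r σ = r₂ σ) :
    r = r₁ ∨ r = r₂ :=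
  ContinuousMonoidHom.eq_or_eq_of_dense r r₁ r₂ hP
    (by
      rintro σ ⟨v, hv, 𝔓, h𝔓, hσ⟩
      exact h v hv 𝔓 h𝔓 σ hσ)

/-- **Frobenius form outside a finite set, zero hypotheses.**  Framed Galois representations
`r r₁ r₂ : Γ_K →ₜ* GL_n(A)` of a number field with `r(Frob) ∈ {r₁(Frob), r₂(Frob)}` at every arithmetic
Frobenius over every place `v ∉ S`, `S` finite, satisfy `r = r₁ ∨ r = r₂` — Frobenius density
(`absoluteGaloisGroup.frobenius_dense`, from Chebotarev `Automorphic.chebotarev_artinRep_holds`) and §1.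
[cite: Rajan2000, Thm. 1 p. 691 (case m = 1)] [cite: SerreAbelianLadic1968, Ch. I §2.2 Cor. 2 (a) p. I-8] -/
theorem FramedGaloisRep.eq_or_eq_of_frobenius [T2Space A] (r r₁ r₂ : FramedGaloisRep K A n)
    {S : Set (HeightOneSpectrum (𝓞 K))} (hS : S.Finite)
    (h : ∀ v ∉ S, ∀ 𝔓 ∈ v.primesAbove, ∀ σ : absoluteGaloisGroup K, IsArithFrobAt (𝓞 K) σ 𝔓 →
      r σ = r₁ σ ∨ r σ = r₂ σ) :
    r = r₁ ∨ r = r₂ :=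
  FramedGaloisRep.eq_or_eq_of_frobenius_of_dense r r₁ r₂ Sᶜ
    (by
      simpa only [Set.mem_compl_iff] using
        absoluteGaloisGroup.frobenius_dense Automorphic.chebotarev_artinRep_holds K S hS)
    (fun v hv => h v hv)

omit [NumberField K] in
/-- In rank one the characteristic polynomial of `r g` determines `r g` (a `1 × 1` matrix is its trace,
Mathlib `Matrix.trace_fin_one`, and the trace is a coefficient of the characteristic polynomial,
`Matrix.trace_eq_neg_charpoly_coeff`). [cite: SerreAbelianLadic1968, Ch. I §2.3] -/
theorem FramedRep.apply_eq_of_charpoly_eq {G : Type*} [Group G] [TopologicalSpace G]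
    {r r' : FramedRep G A 1} {g : G} (h : FramedRep.charpoly r g = FramedRep.charpoly r' g) :
    r g = r' g := by
  have ht : ((r g : GL (Fin 1) A) : Matrix (Fin 1) (Fin 1) A).trace =
      ((r' g : GL (Fin 1) A) : Matrix (Fin 1) (Fin 1) A).trace := by
    rw [Matrix.trace_eq_neg_charpoly_coeff, Matrix.trace_eq_neg_charpoly_coeff]
    change -((FramedRep.charpoly r g).coeff _) = -((FramedRep.charpoly r' g).coeff _)
    rw [h]
  rw [Matrix.trace_fin_one, Matrix.trace_fin_one] at ht
  refine Units.ext (Matrix.ext fun i j => ?_)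
  rw [Subsingleton.elim i 0, Subsingleton.elim j 0]
  exact ht

omit [NumberField K] in
/-- The rank-one characteristic polynomial: `charpoly (r g) = X - C (r g)₀₀`. [cite: SerreAbelianLadic1968, Ch. I §2.3] -/
theorem FramedRep.charpoly_eq_X_sub_C {G : Type*} [Group G] [TopologicalSpace G] (r : FramedRep G A 1) (g : G) :
    FramedRep.charpoly r g = X - C (((r g : GL (Fin 1) A) : Matrix (Fin 1) (Fin 1) A) 0 0) := by
  unfold FramedRep.charpoly Matrix.charpoly
  rw [Matrix.det_fin_one, Matrix.charmatrix_apply_eq]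

omit [NumberField K] in
/-- **Rank-one charpoly form** (the shape `HeckeCharacter.IsAlgebraic.exists_lAdic` delivers).  Let
`r r₁ r₂ : Γ_K →ₜ* GL_1(A)` and `P` a place set with dense Frobenii.  Suppose that at every `v ∈ P` there are
`a a₁ a₂ : A` with `r`, `r₁`, `r₂` having arithmetic-Frobenius characteristic polynomials `X - C a`, `X - C a₁`,
`X - C a₂` at `v` and `a = a₁ ∨ a = a₂`.  Then `r = r₁ ∨ r = r₂`.
[cite: Rajan2000, Thm. 1 p. 691 (case m = 1)] [cite: SerreAbelianLadic1968, Ch. I §2.2 Cor. 2 (a), §2.3] -/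
theorem FramedGaloisRep.eq_or_eq_of_hasFrobCharpolyAt [T2Space A] (r r₁ r₂ : FramedGaloisRep K A 1)
    (P : Set (HeightOneSpectrum (𝓞 K)))
    (hP : Dense {σ : absoluteGaloisGroup K | ∃ v ∈ P, ∃ 𝔓 ∈ v.primesAbove, IsArithFrobAt (𝓞 K) σ 𝔓})
    (h : ∀ v ∈ P, ∃ a a₁ a₂ : A, r.HasFrobCharpolyAt v (X - C a) ∧ r₁.HasFrobCharpolyAt v (X - C a₁) ∧
      r₂.HasFrobCharpolyAt v (X - C a₂) ∧ (a = a₁ ∨ a = a₂)) :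
    r = r₁ ∨ r = r₂ := by
  refine FramedGaloisRep.eq_or_eq_of_frobenius_of_dense r r₁ r₂ P hP fun v hv 𝔓 h𝔓 σ hσ => ?_
  obtain ⟨a, a₁, a₂, ha, ha₁, ha₂, haa⟩ := h v hv
  have e := ha 𝔓 h𝔓 σ hσ
  have e₁ := ha₁ 𝔓 h𝔓 σ hσ
  have e₂ := ha₂ 𝔓 h𝔓 σ hσ
  rcases haa with haa | haa
  · left
    exact FramedRep.apply_eq_of_charpoly_eq (e.trans (haa ▸ e₁.symm))
  · right
    exact FramedRep.apply_eq_of_charpoly_eq (e.trans (haa ▸ e₂.symm))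

end Frobenius

/-! ### §3 The Hecke side: algebraic Hecke characters -/

section Hecke

variable {K : Type} [Field K] [NumberField K]

/-- The finite places above a rational prime `ℓ` form a finite set (they divide the nonzero ideal `(ℓ)`;
Mathlib `Ideal.finite_factors`).  Private copy of the tree's `finite_setOf_natCast_mem_asIdeal`
(`AdmissibleExtensionRegime`, whose deformation-theoretic import closure is not wanted here). [folklore] -/
private theorem finite_setOf_natCast_mem_asIdeal_aux (ℓ : ℕ) [Fact ℓ.Prime] :
    {v : HeightOneSpectrum (𝓞 K) | ((ℓ : ℕ) : 𝓞 K) ∈ v.asIdeal}.Finite := by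
  have hne : (Ideal.span {((ℓ : ℕ) : 𝓞 K)} : Ideal (𝓞 K)) ≠ ⊥ := by
    rw [Ne, Ideal.span_singleton_eq_bot]
    exact_mod_cast (Fact.out : ℓ.Prime).ne_zero
  refine (Ideal.finite_factors hne).subset fun v hv => ?_
  simp only [Set.mem_setOf_eq] at hv ⊢
  rw [Ideal.dvd_iff_le, Ideal.span_singleton_le_iff_mem]
  exact hv

omit [NumberField K] in
/-- From a rank-one Frobenius characteristic polynomial `X - C a` of `r` at `v` and an arithmetic Frobenius
`σ` at some `𝔓 ∣ v`: `(r σ)₀₀ = a`. [cite: SerreAbelianLadic1968, Ch. I §2.3] -/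
theorem FramedGaloisRep.apply_eq_of_hasFrobCharpolyAt {A : Type*} [CommRing A] [TopologicalSpace A]
    {r : FramedGaloisRep K A 1} {v : HeightOneSpectrum (𝓞 K)} {a : A} (h : r.HasFrobCharpolyAt v (X - C a))
    {𝔓 : Ideal (absIntegers (𝓞 K) K)} (h𝔓 : 𝔓 ∈ v.primesAbove) {σ : absoluteGaloisGroup K}
    (hσ : IsArithFrobAt (𝓞 K) σ 𝔓) :
    ((r σ : GL (Fin 1) A) : Matrix (Fin 1) (Fin 1) A) 0 0 = a := by
  have e := h 𝔓 h𝔓 σ hσ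
  rw [FramedRep.charpoly_eq_X_sub_C, sub_right_inj, C_inj] at e
  exact e

/-- **Hecke side, Frobenius-dense place sets.**  Let `ψ μ₁ μ₂` be ALGEBRAIC Hecke characters of the number
field `K` and `P` a set of finite places whose arithmetic Frobenii remain dense in `Γ_K` after removing any
finite set of places.  If `ψ(ϖ_v) = μ₁(ϖ_v)` or `ψ(ϖ_v) = μ₂(ϖ_v)` at every `v ∈ P`, then `ψ = μ₁` or
`ψ = μ₂`.  Proof: Weil's `2`-adic characters `r, r₁, r₂` of `ψ, μ₁, μ₂` (`HeckeCharacter.IsAlgebraic.exists_lAdic`,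
arithmetic Frobenius ↦ `ι⁻¹(χ(ϖ_v))⁻¹`) satisfy the hypothesis of `FramedGaloisRep.eq_or_eq_of_hasFrobCharpolyAt`
over `P` minus the finitely many places above `2` or ramified for one of the three characters; so `r = r_i`,
whence `ψ(ϖ_v) = μ_i(ϖ_v)` for almost all `v` (a Frobenius exists at every place,
`HeightOneSpectrum.exists_isArithFrobAt_of_mem_primesAbove_holds`) and `ψ = μ_i` by rigidity
(`HeckeCharacter.ext_of_eventually_valueAtUniformizer_eq`).
[cite: Rajan2000, Thm. 1 p. 691 (case m = 1)] [cite: Weil1956, §1–§2] [cite: SerreAbelianLadic1968, Ch. I §2.2 Cor. 2 (a) p. I-8] -/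
theorem HeckeCharacter.IsAlgebraic.eq_or_eq_of_valueAtUniformizer_of_dense {ψ μ₁ μ₂ : HeckeCharacter K}
    (hψ : ψ.IsAlgebraic) (hμ₁ : μ₁.IsAlgebraic) (hμ₂ : μ₂.IsAlgebraic) (P : Set (HeightOneSpectrum (𝓞 K)))
    (hP : ∀ T : Set (HeightOneSpectrum (𝓞 K)), T.Finite →
      Dense {σ : absoluteGaloisGroup K | ∃ v ∈ P, v ∉ T ∧ ∃ 𝔓 ∈ v.primesAbove, IsArithFrobAt (𝓞 K) σ 𝔓})
    (h : ∀ v ∈ P, ψ.valueAtUniformizer v = μ₁.valueAtUniformizer v ∨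
      ψ.valueAtUniformizer v = μ₂.valueAtUniformizer v) :
    ψ = μ₁ ∨ ψ = μ₂ := by
  classical
  -- Weil's `2`-adic avatars
  obtain ⟨ι⟩ := PadicAlgCl.nonempty_ringEquiv_complex 2
  obtain ⟨r, hr⟩ := hψ.exists_lAdic (ℓ := 2) ι
  obtain ⟨r₁, hr₁⟩ := hμ₁.exists_lAdic (ℓ := 2) ι
  obtain ⟨r₂, hr₂⟩ := hμ₂.exists_lAdic (ℓ := 2) ι
  -- the finite set of bad places: above `2`, or ramified for one of the three characters
  set T : Set (HeightOneSpectrum (𝓞 K)) :=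
    {v | ((2 : ℕ) : 𝓞 K) ∈ v.asIdeal} ∪ (ψ.ramifiedPlaces ∪ μ₁.ramifiedPlaces ∪ μ₂.ramifiedPlaces) with hTdef
  have hT : T.Finite :=
    (finite_setOf_natCast_mem_asIdeal_aux 2).union
      (((HeckeCharacter.finite_ramifiedPlaces_holds ψ).union (HeckeCharacter.finite_ramifiedPlaces_holds μ₁)).union
        (HeckeCharacter.finite_ramifiedPlaces_holds μ₂))
  have hgood : ∀ v ∉ T, ((2 : ℕ) : 𝓞 K) ∉ v.asIdeal ∧ ψ.IsUnramifiedAt v ∧ μ₁.IsUnramifiedAt v ∧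
      μ₂.IsUnramifiedAt v := by
    intro v hv
    simp only [hTdef, Set.mem_union, Set.mem_setOf_eq, HeckeCharacter.ramifiedPlaces, not_or, not_not] at hv
    exact ⟨hv.1, hv.2.1.1, hv.2.1.2, hv.2.2⟩
  -- the Galois side over `P \ T`
  have hG : r = r₁ ∨ r = r₂ := by
    refine FramedGaloisRep.eq_or_eq_of_hasFrobCharpolyAt r r₁ r₂ {v | v ∈ P ∧ v ∉ T} ?_ ?_
    · have hd := hP T hT
      refine hd.mono ?_
      rintro σ ⟨v, hvP, hvT, 𝔓, h𝔓, hσ⟩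
      exact ⟨v, ⟨hvP, hvT⟩, 𝔓, h𝔓, hσ⟩
    · rintro v ⟨hvP, hvT⟩
      obtain ⟨h2, hu, hu₁, hu₂⟩ := hgood v hvT
      refine ⟨ι.symm (ψ.valueAtUniformizer v)⁻¹, ι.symm (μ₁.valueAtUniformizer v)⁻¹,
        ι.symm (μ₂.valueAtUniformizer v)⁻¹, (hr v h2 hu).2, (hr₁ v h2 hu₁).2, (hr₂ v h2 hu₂).2, ?_⟩
      rcases h v hvP with e | e
      · exact Or.inl (by rw [e])
      · exact Or.inr (by rw [e])
  -- back to the Hecke side: values agree off `T`, then rigidity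
  have key : ∀ {μ : HeckeCharacter K} {rμ : FramedGaloisRep K (PadicAlgCl 2) 1},
      (∀ v : HeightOneSpectrum (𝓞 K), ((2 : ℕ) : 𝓞 K) ∉ v.asIdeal → μ.IsUnramifiedAt v →
        rμ.IsUnramifiedAt v ∧ rμ.HasFrobCharpolyAt v (X - C (ι.symm (μ.valueAtUniformizer v)⁻¹))) →
      (∀ v ∉ T, μ.IsUnramifiedAt v) → r = rμ → ψ = μ := by
    intro μ rμ hrμ huμ hre
    apply HeckeCharacter.ext_of_eventually_valueAtUniformizer_eq
    refine Filter.mem_of_superset hT.compl_mem_cofinite fun v hv => ?_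
    have hvT : v ∉ T := hv
    obtain ⟨h2, hu, -, -⟩ := hgood v hvT
    obtain ⟨𝔓, h𝔓⟩ := v.primesAbove_nonempty
    obtain ⟨σ, hσ⟩ := HeightOneSpectrum.exists_isArithFrobAt_of_mem_primesAbove_holds h𝔓
    have e := FramedGaloisRep.apply_eq_of_hasFrobCharpolyAt (hr v h2 hu).2 h𝔓 hσ
    have eμ := FramedGaloisRep.apply_eq_of_hasFrobCharpolyAt (hrμ v h2 (huμ v hvT)).2 h𝔓 hσ
    rw [hre] at e
    have : ι.symm (ψ.valueAtUniformizer v)⁻¹ = ι.symm (μ.valueAtUniformizer v)⁻¹ := e.symm.trans eμ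
    exact inv_injective (ι.symm.injective this)
  rcases hG with hG | hG
  · exact Or.inl (key hr₁ (fun v hv => (hgood v hv).2.2.1) hG)
  · exact Or.inr (key hr₂ (fun v hv => (hgood v hv).2.2.2) hG)

/-- **Hecke side, finite exceptional set (the «(S-Raj)» step of [Liu2021, Thm. D.6 (1)] as a theorem).**
Algebraic Hecke characters `ψ μ₁ μ₂` of a number field `K` with `ψ(ϖ_v) = μ₁(ϖ_v)` or `ψ(ϖ_v) = μ₂(ϖ_v)` for
every finite place `v` outside a finite set `S` satisfy `ψ = μ₁` or `ψ = μ₂`.  No «`η` of finite order» and no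
density-form Chebotarev: `eq_or_eq_of_valueAtUniformizer_of_dense` with `P = Sᶜ`, the density being
`absoluteGaloisGroup.frobenius_dense` (Chebotarev `Automorphic.chebotarev_artinRep_holds`).
[cite: Rajan2000, Thm. 1 p. 691 (case m = 1)] [cite: Weil1956, §1–§2] [cite: SerreAbelianLadic1968, Ch. I §2.2 Cor. 2 (a) p. I-8] -/
theorem HeckeCharacter.IsAlgebraic.eq_or_eq_of_valueAtUniformizer {ψ μ₁ μ₂ : HeckeCharacter K}
    (hψ : ψ.IsAlgebraic) (hμ₁ : μ₁.IsAlgebraic) (hμ₂ : μ₂.IsAlgebraic) {S : Set (HeightOneSpectrum (𝓞 K))}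
    (hS : S.Finite)
    (h : ∀ v ∉ S, ψ.valueAtUniformizer v = μ₁.valueAtUniformizer v ∨
      ψ.valueAtUniformizer v = μ₂.valueAtUniformizer v) :
    ψ = μ₁ ∨ ψ = μ₂ := by
  refine hψ.eq_or_eq_of_valueAtUniformizer_of_dense hμ₁ hμ₂ Sᶜ (fun T hT => ?_) (fun v hv => h v hv)
  have hd := absoluteGaloisGroup.frobenius_dense Automorphic.chebotarev_artinRep_holds K (S ∪ T) (hS.union hT)
  refine hd.mono ?_
  rintro σ ⟨v, hv, 𝔓, h𝔓, hσ⟩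
  rw [Set.mem_union, not_or] at hv
  exact ⟨v, hv.1, hv.2, 𝔓, h𝔓, hσ⟩

/-- **Eventually form** of `eq_or_eq_of_valueAtUniformizer` (hypothesis along `Filter.cofinite`).
[cite: Rajan2000, Thm. 1 p. 691 (case m = 1)] [cite: Weil1956, §1–§2] -/
theorem HeckeCharacter.IsAlgebraic.eq_or_eq_of_eventually {ψ μ₁ μ₂ : HeckeCharacter K}
    (hψ : ψ.IsAlgebraic) (hμ₁ : μ₁.IsAlgebraic) (hμ₂ : μ₂.IsAlgebraic)
    (h : ∀ᶠ v in cofinite, ψ.valueAtUniformizer v = μ₁.valueAtUniformizer v ∨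
      ψ.valueAtUniformizer v = μ₂.valueAtUniformizer v) :
    ψ = μ₁ ∨ ψ = μ₂ := by
  have hS : {v | ¬ (ψ.valueAtUniformizer v = μ₁.valueAtUniformizer v ∨
      ψ.valueAtUniformizer v = μ₂.valueAtUniformizer v)}.Finite := Filter.eventually_cofinite.1 h
  exact hψ.eq_or_eq_of_valueAtUniformizer hμ₁ hμ₂ hS fun v hv => not_not.1 hv

end Hecke

end Literature.NumberTheory.GaloisRepresentations

end
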